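import Summits.QuantumFields.YangMills.Theorems.FradkinShenkerFlowSusceptibilityToPoincarePinnedGlauberLeHeatBath

/-!
# Rider `stub_fineClause_mono` (R_A) of the line `rg-variance-cascade` (crux `SusceptibilityToPoincare`)

Route `FradkinShenkerFlow` of `YangMills`, crux item `stmt-QuantumFields-9441`
(`Summit.QuantumFields.YangMills.Theses.FradkinShenkerFlow.SusceptibilityToPoincare`, FS ⇒ UP),
registered skeleton `Cruxes/SusceptibilityToPoincare/Lines/rg_variance_cascade.lean`, rider R_A:
**only the first block level matters for the fine clause of `stub_fluctuationPoincare`** — the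
fine clause for the ONE-level joint law `P⁽¹⁾` of the Wilson field and its scale-`b` block field
implies it, with the same constant, for the `n`-level joint law `P⁽ⁿ⁾`, every `n ≥ 1`.

* MARGINAL: `P⁽ⁿ⁾.map (U, V) ↦ (U, V⁰) = P⁽¹⁾` (`FineClauseMono.map_prodMap_tilted_prod_shear`):
  after the fibrewise Haar-preserving shears `V^k_e ↦ V^k_e h_{k,e}(U)⁻¹` of `stub_jointMarginal`
  both laws are `μ ⊗ (Haar^{⊗}.tilted ψ)` with the LEVEL SUM `ψ(V) = Σ_k φ_k(V^k)`, the shears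
  commute with the projection, and the `V⁰`-block of a product of Haar measures tilted by a level
  sum is the `V⁰`-factor tilted by `φ_0` (`FineClauseMono.map_eval_pi_tilted_sum`:
  `MeasurableEquiv.piFinSuccAbove`, `tilted_tilted`, `JointMarginal.tilted_prod_snd`).
* PROJECTION (`PinnedGlauber.integral_sub_condExp_sq_le_integral_sub_sq`): `E[·|m]` is the
  `L²`-nearest `m`-measurable function, and `E_{P⁽¹⁾}[F∘fst | σ(V⁰)] ∘ π` is `σ(V⁰,…,V^{n−1})`-measurable.
* TRANSFER: `∫ (F∘fst − h∘π)² dP⁽ⁿ⁾ = ∫ (F∘fst − h)² dP⁽¹⁾` (`integral_map`), then the hypothesis.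
-/

noncomputable section

open MeasureTheory ProbabilityTheory
open Literature.MathematicalPhysics.QuantumFieldTheory

namespace Summit.QuantumFields.YangMills.Theorems.SusceptibilityToPoincare.RgVarianceCascade

namespace FineClauseMono

section Abstract

variable {X Y Y' : Type*} [MeasurableSpace X] [MeasurableSpace Y] [MeasurableSpace Y']

/-- **First marginal of a product tilted by a separable function**: for probability measures
`μ`, `ν` and measurable `f`, `g` with `g` bounded above (so that the `g`-tilt of `ν` is a
probability measure), `((μ ⊗ ν).tilted (f ∘ fst + g ∘ snd)).map fst = μ.tilted f`. [folklore] -/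
theorem map_fst_tilted_prod_add {μ : Measure X} {ν : Measure Y} [IsProbabilityMeasure μ]
    [IsProbabilityMeasure ν] {f : X → ℝ} {g : Y → ℝ} (hf : Measurable f) (hg : Measurable g)
    {C : ℝ} (hgC : ∀ y, g y ≤ C) :
    ((μ.prod ν).tilted fun z : X × Y => f z.1 + g z.2).map Prod.fst = μ.tilted f := by
  have hexp : Measurable fun y => Real.exp (g y) := Real.measurable_exp.comp hg
  have hbd : ∀ y, ‖Real.exp (g y)‖ ≤ Real.exp C := fun y => by
    rw [Real.norm_eq_abs, Real.abs_exp]; exact Real.exp_le_exp.2 (hgC y)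
  have hgi : Integrable (fun y => Real.exp (g y)) ν :=
    Integrable.of_bound hexp.aestronglyMeasurable (Real.exp C) (ae_of_all _ hbd)
  have hgi2 : Integrable (fun z : X × Y => Real.exp (g z.2)) (μ.prod ν) :=
    Integrable.of_bound (hexp.comp measurable_snd).aestronglyMeasurable (Real.exp C)
      (ae_of_all _ fun z => hbd z.2)
  have h1 : ((μ.prod ν).tilted fun z : X × Y => f z.1 + g z.2) =
      ((μ.prod ν).tilted fun z : X × Y => g z.2).tilted fun z : X × Y => f z.1 := by
    rw [tilted_tilted hgi2]; exact congrArg _ (funext fun z => add_comm _ _)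
  haveI : IsProbabilityMeasure (ν.tilted g) := isProbabilityMeasure_tilted hgi
  rw [h1, JointMarginal.tilted_prod_snd μ ν hg]
  exact JointMarginal.map_tilted_comp (measurePreserving_fst (μ := μ) (ν := ν.tilted g)) hf

/-- **One coordinate of a product of probability measures tilted by a sum over coordinates**:
`((⊗_k η_k).tilted (V ↦ Σ_k φ_k(V_k))).map (eval i) = η_i.tilted φ_i` (`φ_k` measurable, bounded
above): split off coordinate `i` (`MeasurableEquiv.piFinSuccAbove`), the rest integrates out. [folklore] -/
theorem map_eval_pi_tilted_sum {m : ℕ} {α : Fin (m + 1) → Type*} [∀ k, MeasurableSpace (α k)]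
    (η : ∀ k, Measure (α k)) [∀ k, IsProbabilityMeasure (η k)] {φ : ∀ k, α k → ℝ}
    (hφm : ∀ k, Measurable (φ k)) {C : Fin (m + 1) → ℝ} (hφC : ∀ k x, φ k x ≤ C k)
    (i : Fin (m + 1)) :
    ((Measure.pi η).tilted fun V => ∑ k, φ k (V k)).map (Function.eval i) =
      (η i).tilted (φ i) := by
  have he := measurePreserving_piFinSuccAbove η i
  set e := MeasurableEquiv.piFinSuccAbove α i
  obtain ⟨Ψ, hΨ⟩ : ∃ Ψ : α i × (∀ j, α (i.succAbove j)) → ℝ,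
      Ψ = fun z => φ i z.1 + ∑ j, φ (i.succAbove j) (z.2 j) := ⟨_, rfl⟩
  have hΨm : Measurable Ψ := by
    rw [hΨ]
    exact ((hφm i).comp measurable_fst).add
      (Finset.measurable_sum _ fun j _ => (hφm _).comp ((measurable_pi_apply j).comp measurable_snd))
  have hsum : ((Measure.pi η).tilted fun V => ∑ k, φ k (V k)) =
      (Measure.pi η).tilted fun V => Ψ (e V) := by
    congr 1; funext V
    rw [hΨ, Fin.sum_univ_succAbove _ i]; rfl
  have hgm : Measurable fun W : (∀ j, α (i.succAbove j)) => ∑ j, φ (i.succAbove j) (W j) :=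
    Finset.measurable_sum _ fun j _ => (hφm _).comp (measurable_pi_apply j)
  have hgC : ∀ W : (∀ j, α (i.succAbove j)),
      ∑ j, φ (i.succAbove j) (W j) ≤ ∑ j, C (i.succAbove j) :=
    fun W => Finset.sum_le_sum fun j _ => hφC _ _
  calc ((Measure.pi η).tilted fun V => ∑ k, φ k (V k)).map (Function.eval i)
      = (((Measure.pi η).tilted fun V => Ψ (e V)).map e).map Prod.fst := by
        rw [hsum]
        exact (Measure.map_map measurable_fst e.measurable).symm
    _ = (((η i).prod (Measure.pi fun j => η (i.succAbove j))).tilted Ψ).map Prod.fst := by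
        rw [JointMarginal.map_tilted_comp he hΨm]
    _ = (η i).tilted (φ i) := by
        rw [hΨ]
        exact map_fst_tilted_prod_add (μ := η i) (ν := Measure.pi fun j => η (i.succAbove j))
          (f := φ i) (g := fun W : (∀ j, α (i.succAbove j)) => ∑ j, φ (i.succAbove j) (W j))
          (hφm i) hgm hgC

/-- **The level-`0` block of a product of probability measures tilted by a level sum** (family
indexed by `ℕ`, truncated at `m + 1` resp. `1` levels): restricting
`(⊗_{k<m+1} η_k).tilted (Σ_{k<m+1} φ_k)` to the `Fin 1`-indexed sub-family gives
`(⊗_{k<1} η_k).tilted (Σ_{k<1} φ_k)` (both have the marginal `η_0.tilted φ_0`). [folklore] -/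
theorem map_pi_tilted_sum_fin_one {α : ℕ → Type*} [∀ j, MeasurableSpace (α j)]
    (η : ∀ j, Measure (α j)) [∀ j, IsProbabilityMeasure (η j)] {φ : ∀ j, α j → ℝ}
    (hφm : ∀ j, Measurable (φ j)) {C : ℕ → ℝ} (hφC : ∀ j x, φ j x ≤ C j) (m : ℕ)
    (h : 1 ≤ m + 1) :
    ((Measure.pi fun k : Fin (m + 1) => η k).tilted fun V => ∑ k : Fin (m + 1), φ k (V k)).map
        (fun V k => V (Fin.castLE h k) : ((k : Fin (m + 1)) → α k) → ((k : Fin 1) → α k)) =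
      (Measure.pi fun k : Fin 1 => η k).tilted fun V => ∑ k : Fin 1, φ k (V k) := by
  have hp : Measurable
      (fun V k => V (Fin.castLE h k) : ((k : Fin (m + 1)) → α k) → ((k : Fin 1) → α k)) :=
    measurable_pi_lambda _ fun k => measurable_pi_apply _
  have h1 := map_eval_pi_tilted_sum (fun k : Fin (m + 1) => η k) (φ := fun k => φ k)
    (fun k => hφm k) (C := fun k => C k) (fun k => hφC k) (Fin.castLE h default)
  have h2 := map_eval_pi_tilted_sum (fun k : Fin 1 => η k) (φ := fun k => φ k)
    (fun k => hφm k) (C := fun k => C k) (fun k => hφC k) default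
  refine (MeasurableEquiv.piUnique fun k : Fin 1 => α k).map_measurableEquiv_injective ?_
  exact ((Measure.map_map (MeasurableEquiv.piUnique fun k : Fin 1 => α k).measurable hp).trans
    h1).trans h2.symm

/-- **Compatible shears: the image of a sheared tilt of `μ ⊗ π` under `id × p` is the sheared
tilt of `μ ⊗ π'`.**  Let `μ`, `π`, `π'` be probability measures, `g`, `g'` measurable shears
preserving `π` resp. `π'` fibrewise, with `p ∘ g x = g' x ∘ p`, `g' x` having the measurable
left inverse `gi x`, and `(π.tilted ψ).map p = π'.tilted ψ'`.  Then
`((μ ⊗ π).tilted (ψ ∘ g)).map (id × p) = (μ ⊗ π').tilted (ψ' ∘ g')`: both sides agree after the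
skew product by `g'` (`JointMarginal.map_tilted_comp`), which is cancelled by `gi`. [folklore] -/
theorem map_prodMap_tilted_prod_shear {μ : Measure X} {π : Measure Y} {π' : Measure Y'}
    [IsProbabilityMeasure μ] [IsProbabilityMeasure π] [IsProbabilityMeasure π']
    {g : X → Y → Y} (hgm : Measurable (Function.uncurry g)) (hg : ∀ x, π.map (g x) = π)
    {g' : X → Y' → Y'} (hgm' : Measurable (Function.uncurry g'))
    (hg' : ∀ x, π'.map (g' x) = π')
    {gi : X → Y' → Y'} (hgim : Measurable (Function.uncurry gi))
    (hgi : ∀ x y, gi x (g' x y) = y)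
    {p : Y → Y'} (hp : Measurable p) (hpg : ∀ x y, p (g x y) = g' x (p y))
    {ψ : Y → ℝ} (hψm : Measurable ψ) {ψ' : Y' → ℝ} (hψm' : Measurable ψ')
    (hmarg : (π.tilted ψ).map p = π'.tilted ψ') :
    ((μ.prod π).tilted fun ω => ψ (g ω.1 ω.2)).map (Prod.map id p) =
      (μ.prod π').tilted fun ω => ψ' (g' ω.1 ω.2) := by
  have hT : MeasurePreserving (fun ω : X × Y => (ω.1, g ω.1 ω.2)) (μ.prod π) (μ.prod π) :=
    (MeasurePreserving.id μ).skew_product hgm (ae_of_all _ hg)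
  have hT' : MeasurePreserving (fun ω : X × Y' => (ω.1, g' ω.1 ω.2)) (μ.prod π') (μ.prod π') :=
    (MeasurePreserving.id μ).skew_product hgm' (ae_of_all _ hg')
  have key : (((μ.prod π).tilted fun ω => ψ (g ω.1 ω.2)).map fun ω : X × Y => (ω.1, g ω.1 ω.2)) =
      μ.prod (π.tilted ψ) :=
    (JointMarginal.map_tilted_comp hT (ψ := fun ω : X × Y => ψ ω.2)
      (hψm.comp measurable_snd)).trans (JointMarginal.tilted_prod_snd μ π hψm)
  have key' : (((μ.prod π').tilted fun ω => ψ' (g' ω.1 ω.2)).map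
      fun ω : X × Y' => (ω.1, g' ω.1 ω.2)) = μ.prod (π'.tilted ψ') :=
    (JointMarginal.map_tilted_comp hT' (ψ := fun ω : X × Y' => ψ' ω.2)
      (hψm'.comp measurable_snd)).trans (JointMarginal.tilted_prod_snd μ π' hψm')
  have hpm : Measurable (Prod.map id p : X × Y → X × Y') := measurable_id.prodMap hp
  have h1 : (((μ.prod π).tilted fun ω => ψ (g ω.1 ω.2)).map (Prod.map id p)).map
      (fun ω : X × Y' => (ω.1, g' ω.1 ω.2)) = μ.prod (π'.tilted ψ') := by
    have hcomm : (fun ω : X × Y' => (ω.1, g' ω.1 ω.2)) ∘ (Prod.map id p : X × Y → X × Y') =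
        (Prod.map id p : X × Y → X × Y') ∘ fun ω : X × Y => (ω.1, g ω.1 ω.2) :=
      funext fun ω => Prod.ext rfl (hpg ω.1 ω.2).symm
    rw [Measure.map_map hT'.measurable hpm, hcomm, ← Measure.map_map hpm hT.measurable, key,
      ← Measure.map_prod_map μ (π.tilted ψ) measurable_id hp, Measure.map_id, hmarg]
  -- the skew product by `g'` is cancelled by the skew product by `gi`
  have hTi : Measurable fun ω : X × Y' => (ω.1, gi ω.1 ω.2) := measurable_fst.prodMk hgim
  have cancel : ∀ ν : Measure (X × Y'),
      (ν.map fun ω : X × Y' => (ω.1, g' ω.1 ω.2)).map (fun ω : X × Y' => (ω.1, gi ω.1 ω.2)) =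
        ν := fun ν => by
    rw [Measure.map_map hTi hT'.measurable, show (fun ω : X × Y' => (ω.1, gi ω.1 ω.2)) ∘
      (fun ω : X × Y' => (ω.1, g' ω.1 ω.2)) = id from funext fun ω => Prod.ext rfl (hgi ω.1 ω.2),
      Measure.map_id]
  rw [← cancel (((μ.prod π).tilted fun ω => ψ (g ω.1 ω.2)).map (Prod.map id p)), h1, ← key',
    cancel]

end Abstract

/-- The inverse shear `(U, W) ↦ (k, e) ↦ W^k_e · h_{k,e}(U)` by the straight transporters of the
fine field (torus of side `2S+1`) is jointly measurable. [folklore] -/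
theorem measurable_unshear {G : Type} [Group G] [TopologicalSpace G] [IsTopologicalGroup G]
    [MeasurableSpace G] [BorelSpace G] [SecondCountableTopology G] (S b n : ℕ) [NeZero b] :
    Measurable fun ω : GaugeConfig 4 (2 * S + 1) G ×
        ((k : Fin n) → GaugeConfig 4 (BalabanAveraging.blockSide (2 * S + 1) (b ^ ((k : ℕ) + 1))) G) =>
      fun (k : Fin n) (e : Edge 4 (BalabanAveraging.blockSide (2 * S + 1) (b ^ ((k : ℕ) + 1)))) =>
        ω.2 k e * BalabanAveraging.link (2 * S + 1) (b ^ ((k : ℕ) + 1))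
          (BalabanAveraging.BlockMean.rep 0) ω.1 e := by
  refine measurable_pi_lambda _ fun k => measurable_pi_lambda _ fun e => ?_
  have hl := BalabanAveraging.measurable_link (d := 4) (N := 2 * S + 1) (b := b ^ ((k : ℕ) + 1))
    (G := G) (BalabanAveraging.BlockMean.rep 0)
  fun_prop

end FineClauseMono

/-- Rider R_A `stub_fineClause_mono`: **only the first block level matters for B's fine
clause** — the fine clause of `stub_fluctuationPoincare` for the ONE-level family (`n = 1`)
with constant `γ` at side `2S+1` implies it with the same `γ` for the `n`-level family, every
`n ≥ 1`: with `π(U, V) = (U, V^0)` one has `P⁽ⁿ⁾.map π = P⁽¹⁾`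
(`FineClauseMono.map_prodMap_tilted_prod_shear`, `JointMarginal.map_shear_pi`,
`FineClauseMono.map_pi_tilted_sum_fin_one`), the function `E_{P⁽¹⁾}[F∘fst | σ(V^0)] ∘ π` is
`σ(V^0, …, V^{n−1})`-measurable, so the `L²(P⁽ⁿ⁾)`-residual of `F∘fst` after projection on
`comap (T 0)` is at most `∫ ((F∘fst − E_{P⁽¹⁾}[F∘fst|σ(V^0)]) ∘ π)² dP⁽ⁿ⁾
= ∫ (F∘fst − E_{P⁽¹⁾}[F∘fst | σ(V^0)])² dP⁽¹⁾ ≤ γ HB(F)`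
(`PinnedGlauber.integral_sub_condExp_sq_le_integral_sub_sq`, `integral_map`). [folklore] -/
theorem stub_fineClause_mono :
    ∀ (G : Type) [Group G] [TopologicalSpace G] [IsTopologicalGroup G] [CompactSpace G]
      [MeasurableSpace G] [BorelSpace G] (r : LatticeRep G) (β : ℝ) (b : ℕ) [NeZero b] (s : ℝ) (γ : ℝ) (S : ℕ),
      (∀ (P₁ : Measure (GaugeConfig 4 (2 * S + 1) G ×
          ((k : Fin 1) → GaugeConfig 4 (BalabanAveraging.blockSide (2 * S + 1) (b ^ ((k : ℕ) + 1))) G))),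
        P₁ = ((wilsonMeasure r.ρ β : Measure (GaugeConfig 4 (2 * S + 1) G)).prod
          (Measure.pi fun k : Fin 1 => Measure.pi
            fun _ : Edge 4 (BalabanAveraging.blockSide (2 * S + 1) (b ^ ((k : ℕ) + 1))) => haarProbability G)).tilted
          (fun ω => ∑ k : Fin 1, ∑ e : Edge 4 (BalabanAveraging.blockSide (2 * S + 1) (b ^ ((k : ℕ) + 1))),
            s * (r.ρ (ω.2 k e * (BalabanAveraging.link (2 * S + 1) (b ^ ((k : ℕ) + 1))
              (BalabanAveraging.BlockMean.rep 0) ω.1 e)⁻¹)).trace.re) →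
        ∀ (T₁ : ℕ → GaugeConfig 4 (2 * S + 1) G ×
          ((k : Fin 1) → GaugeConfig 4 (BalabanAveraging.blockSide (2 * S + 1) (b ^ ((k : ℕ) + 1))) G) →
          ((k : Fin 1) → GaugeConfig 4 (BalabanAveraging.blockSide (2 * S + 1) (b ^ ((k : ℕ) + 1))) G)),
        (∀ j ω k, T₁ j ω k = if j ≤ (k : ℕ) then ω.2 k else fun _ => 1) →
        ∀ (F : GaugeConfig 4 (2 * S + 1) G → ℝ), Measurable F → (∃ M : ℝ, ∀ U, |F U| ≤ M) →
        ∫ ω, (F ω.1 - condExp (MeasurableSpace.comap (T₁ 0) inferInstance) P₁ (F ∘ Prod.fst) ω) ^ 2 ∂P₁ ≤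
          γ * ∑ ℓ : Edge 4 (2 * S + 1), ∫ U, ∫ g, (F U - F (Function.update U ℓ g)) ^ 2
            ∂((haarProbability G).tilted (fun g' => -β * wilsonAction r.ρ (Function.update U ℓ g')))
            ∂(wilsonMeasure r.ρ β : Measure (GaugeConfig 4 (2 * S + 1) G))) →
      ∀ (n : ℕ), 1 ≤ n →
      ∀ (P : Measure (GaugeConfig 4 (2 * S + 1) G ×
          ((k : Fin n) → GaugeConfig 4 (BalabanAveraging.blockSide (2 * S + 1) (b ^ ((k : ℕ) + 1))) G))),
      P = ((wilsonMeasure r.ρ β : Measure (GaugeConfig 4 (2 * S + 1) G)).prod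
          (Measure.pi fun k : Fin n => Measure.pi
            fun _ : Edge 4 (BalabanAveraging.blockSide (2 * S + 1) (b ^ ((k : ℕ) + 1))) => haarProbability G)).tilted
          (fun ω => ∑ k : Fin n, ∑ e : Edge 4 (BalabanAveraging.blockSide (2 * S + 1) (b ^ ((k : ℕ) + 1))),
            s * (r.ρ (ω.2 k e * (BalabanAveraging.link (2 * S + 1) (b ^ ((k : ℕ) + 1))
              (BalabanAveraging.BlockMean.rep 0) ω.1 e)⁻¹)).trace.re) →
      ∀ (T : ℕ → GaugeConfig 4 (2 * S + 1) G ×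
          ((k : Fin n) → GaugeConfig 4 (BalabanAveraging.blockSide (2 * S + 1) (b ^ ((k : ℕ) + 1))) G) →
          ((k : Fin n) → GaugeConfig 4 (BalabanAveraging.blockSide (2 * S + 1) (b ^ ((k : ℕ) + 1))) G)),
      (∀ j ω k, T j ω k = if j ≤ (k : ℕ) then ω.2 k else fun _ => 1) →
      ∀ (F : GaugeConfig 4 (2 * S + 1) G → ℝ), Measurable F → (∃ M : ℝ, ∀ U, |F U| ≤ M) →
      ∫ ω, (F ω.1 - condExp (MeasurableSpace.comap (T 0) inferInstance) P (F ∘ Prod.fst) ω) ^ 2 ∂P ≤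
        γ * ∑ ℓ : Edge 4 (2 * S + 1), ∫ U, ∫ g, (F U - F (Function.update U ℓ g)) ^ 2
          ∂((haarProbability G).tilted (fun g' => -β * wilsonAction r.ρ (Function.update U ℓ g')))
          ∂(wilsonMeasure r.ρ β : Measure (GaugeConfig 4 (2 * S + 1) G)) := by
  intro G _ _ _ _ _ _ r β b _ s γ S H₁ n hn P hP T hT F hF hM
  obtain ⟨m, rfl⟩ : ∃ m, n = m + 1 := ⟨n - 1, by omega⟩
  haveI : SecondCountableTopology G :=
    (r.continuous.isClosedEmbedding r.injective).isEmbedding.secondCountableTopology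
  haveI := isProbabilityMeasure_wilsonMeasure (d := 4) (L := 2 * S + 1) (G := G) r.ρ r.continuous β
  haveI hPp : IsProbabilityMeasure P := (stub_jointMarginal G r β b (m + 1) s S P hP).1
  obtain ⟨B, -, hB⟩ := exists_bound_trace_re_nonneg r.ρ r.continuous
  have hφm : ∀ j : ℕ, Measurable
      fun W : GaugeConfig 4 (BalabanAveraging.blockSide (2 * S + 1) (b ^ (j + 1))) G =>
        ∑ e, s * (r.ρ (W e)).trace.re := fun j =>
    Finset.measurable_sum _ fun e _ => measurable_const.mul
      ((continuous_trace_re r.ρ r.continuous).measurable.comp (measurable_pi_apply e))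
  have hφC : ∀ (j : ℕ) (W : GaugeConfig 4 (BalabanAveraging.blockSide (2 * S + 1) (b ^ (j + 1))) G),
      ∑ e, s * (r.ρ (W e)).trace.re ≤
        ∑ _e : Edge 4 (BalabanAveraging.blockSide (2 * S + 1) (b ^ (j + 1))), |s| * B :=
    fun j W => Finset.sum_le_sum fun e _ => (le_abs_self _).trans
      ((abs_mul _ _).trans_le (mul_le_mul_of_nonneg_left (hB _) (abs_nonneg s)))
  -- the projection `p : V ↦ V⁰` onto the level-`0` block field (`Fin 1`-indexed family)
  obtain ⟨p, hp⟩ : ∃ p :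
      ((k : Fin (m + 1)) → GaugeConfig 4 (BalabanAveraging.blockSide (2 * S + 1) (b ^ ((k : ℕ) + 1))) G) →
        ((k : Fin 1) → GaugeConfig 4 (BalabanAveraging.blockSide (2 * S + 1) (b ^ ((k : ℕ) + 1))) G),
      ∀ V, p V = fun k => V (Fin.castLE hn k) := ⟨_, fun _ => rfl⟩
  have hpeq := funext hp
  have hpm : Measurable p := by
    subst hpeq; exact measurable_pi_lambda _ fun k => measurable_pi_apply _
  -- MARGINAL: the image of `P` under `id × p` is the one-level joint law `P₁`
  obtain ⟨P₁, hP₁⟩ : ∃ P₁ : Measure _, P₁ =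
      ((wilsonMeasure r.ρ β : Measure (GaugeConfig 4 (2 * S + 1) G)).prod
        (Measure.pi fun k : Fin 1 => Measure.pi
          fun _ : Edge 4 (BalabanAveraging.blockSide (2 * S + 1) (b ^ ((k : ℕ) + 1))) =>
            haarProbability G)).tilted
        (fun ω => ∑ k : Fin 1,
          ∑ e : Edge 4 (BalabanAveraging.blockSide (2 * S + 1) (b ^ ((k : ℕ) + 1))),
            s * (r.ρ (ω.2 k e * (BalabanAveraging.link (2 * S + 1) (b ^ ((k : ℕ) + 1))
              (BalabanAveraging.BlockMean.rep 0) ω.1 e)⁻¹)).trace.re) := ⟨_, rfl⟩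
  haveI hP₁p : IsProbabilityMeasure P₁ := (stub_jointMarginal G r β b 1 s S P₁ hP₁).1
  have hkey : P.map (Prod.map id p) = P₁ := by
    subst hpeq
    rw [hP, hP₁]
    exact FineClauseMono.map_prodMap_tilted_prod_shear
      (g := fun U (V : (k : Fin (m + 1)) →
          GaugeConfig 4 (BalabanAveraging.blockSide (2 * S + 1) (b ^ ((k : ℕ) + 1))) G) k e =>
        V k e * (BalabanAveraging.link (2 * S + 1) (b ^ ((k : ℕ) + 1))
          (BalabanAveraging.BlockMean.rep 0) U e)⁻¹)
      (JointMarginal.measurable_shear S b (m + 1)) (JointMarginal.map_shear_pi S b (m + 1))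
      (g' := fun U (V : (k : Fin 1) →
          GaugeConfig 4 (BalabanAveraging.blockSide (2 * S + 1) (b ^ ((k : ℕ) + 1))) G) k e =>
        V k e * (BalabanAveraging.link (2 * S + 1) (b ^ ((k : ℕ) + 1))
          (BalabanAveraging.BlockMean.rep 0) U e)⁻¹)
      (JointMarginal.measurable_shear S b 1) (JointMarginal.map_shear_pi S b 1)
      (gi := fun U (W : (k : Fin 1) →
          GaugeConfig 4 (BalabanAveraging.blockSide (2 * S + 1) (b ^ ((k : ℕ) + 1))) G) k e =>
        W k e * BalabanAveraging.link (2 * S + 1) (b ^ ((k : ℕ) + 1))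
          (BalabanAveraging.BlockMean.rep 0) U e)
      (FineClauseMono.measurable_unshear S b 1)
      (fun U W => funext fun k => funext fun e => inv_mul_cancel_right _ _)
      hpm (fun U V => rfl)
      (ψ := fun V => ∑ k : Fin (m + 1),
          ∑ e : Edge 4 (BalabanAveraging.blockSide (2 * S + 1) (b ^ ((k : ℕ) + 1))),
            s * (r.ρ (V k e)).trace.re)
      (JointMarginal.measurable_levelSum r b (m + 1) s S)
      (ψ' := fun V => ∑ k : Fin 1,
          ∑ e : Edge 4 (BalabanAveraging.blockSide (2 * S + 1) (b ^ ((k : ℕ) + 1))),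
            s * (r.ρ (V k e)).trace.re)
      (JointMarginal.measurable_levelSum r b 1 s S)
      (FineClauseMono.map_pi_tilted_sum_fin_one
        (fun j => Measure.pi
          fun _ : Edge 4 (BalabanAveraging.blockSide (2 * S + 1) (b ^ (j + 1))) => haarProbability G)
        hφm hφC m hn)
  -- the truncations at level `0` keep every level
  obtain ⟨T₁, hT₁⟩ : ∃ T₁ : ℕ → GaugeConfig 4 (2 * S + 1) G ×
      ((k : Fin 1) → GaugeConfig 4 (BalabanAveraging.blockSide (2 * S + 1) (b ^ ((k : ℕ) + 1))) G) →
      ((k : Fin 1) → GaugeConfig 4 (BalabanAveraging.blockSide (2 * S + 1) (b ^ ((k : ℕ) + 1))) G),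
      ∀ j ω k, T₁ j ω k = if j ≤ (k : ℕ) then ω.2 k else fun _ => 1 :=
    ⟨fun j ω k => if j ≤ (k : ℕ) then ω.2 k else fun _ => 1, fun _ _ _ => rfl⟩
  have hT0 : T 0 = Prod.snd :=
    funext fun ω => funext fun k => (hT 0 ω k).trans (if_pos (Nat.zero_le _))
  have hT₁0 : T₁ 0 = Prod.snd :=
    funext fun ω => funext fun k => (hT₁ 0 ω k).trans (if_pos (Nat.zero_le _))
  have H := H₁ P₁ hP₁ T₁ hT₁ F hF hM
  set h := condExp (MeasurableSpace.comap (T₁ 0) inferInstance) P₁ (F ∘ Prod.fst)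
  -- PROJECTION: `h ∘ (id × p)` is measurable for the `n`-level conditioning
  have hfac : T₁ 0 ∘ (Prod.map id p) = p ∘ T 0 := by rw [hT0, hT₁0]; rfl
  have hπm' : @Measurable _ _ (MeasurableSpace.comap (T 0) inferInstance)
      (MeasurableSpace.comap (T₁ 0) inferInstance) (Prod.map id p) := by
    rw [measurable_iff_comap_le, MeasurableSpace.comap_comp, hfac, ← MeasurableSpace.comap_comp]
    exact MeasurableSpace.comap_mono hpm.comap_le
  have hhm : StronglyMeasurable[MeasurableSpace.comap (T 0) inferInstance] (h ∘ Prod.map id p) :=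
    ((stronglyMeasurable_condExp (m := MeasurableSpace.comap (T₁ 0) inferInstance) (μ := P₁)
      (f := F ∘ Prod.fst)).measurable.comp hπm').stronglyMeasurable
  have hπm : Measurable (Prod.map (@id (GaugeConfig 4 (2 * S + 1) G)) p) :=
    measurable_id.prodMap hpm
  obtain ⟨M, hMb⟩ := hM
  have hF2₁ : MemLp (F ∘ Prod.fst) 2 P₁ :=
    MemLp.of_bound (hF.comp measurable_fst).aestronglyMeasurable M
      (ae_of_all _ fun ω => by rw [Real.norm_eq_abs]; exact hMb ω.1)
  have hF2 : MemLp (F ∘ Prod.fst) 2 P :=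
    MemLp.of_bound (hF.comp measurable_fst).aestronglyMeasurable M
      (ae_of_all _ fun ω => by rw [Real.norm_eq_abs]; exact hMb ω.1)
  have hg2 : MemLp (h ∘ Prod.map id p) 2 P :=
    MemLp.comp_of_map (by rw [hkey]; exact hF2₁.condExp one_le_two) hπm.aemeasurable
  -- TRANSFER to the one-level law along `id × p`
  have hhmeas : Measurable h :=
    (stronglyMeasurable_condExp.mono (by rw [hT₁0]; exact measurable_snd.comap_le)).measurable
  have htrans : ∫ ω, (F ω.1 - h (Prod.map id p ω)) ^ 2 ∂P = ∫ ω, (F ω.1 - h ω) ^ 2 ∂P₁ := by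
    rw [← hkey]
    exact (integral_map hπm.aemeasurable
      (((hF.comp measurable_fst).sub hhmeas).pow_const 2).aestronglyMeasurable).symm
  exact (PinnedGlauber.integral_sub_condExp_sq_le_integral_sub_sq
    (by rw [hT0]; exact measurable_snd.comap_le) hF2 hg2 hhm).trans (htrans.le.trans H)

end Summit.QuantumFields.YangMills.Theorems.SusceptibilityToPoincare.RgVarianceCascade

end
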